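import Summits.NavierStokesRegularity.FluidComputer.RowPhaseGlobal
import Summits.NavierStokesRegularity.FluidComputer.RowSegment
import HarnessLib

/-!
# The row model, part 7: THE PHASE MAP EXISTS ALONG A WHOLE SEGMENT (layer A′ global, per segment;
# `pub-fluidc-bp3/R1-DESIGN.md` §11.7 (G-e))

HONEST FRAMING (cell `pub-fluidc`, blueprint seat bp3, gen 22): low prior, high value-of-information
experiment on Tao's machine paradigm; NOT a claim that NS blows up.

WHAT. `segment_sound` (and the whole-chain `segAD`) ASSUME, for ONE member data
`m = (y, δF, D, s, ṡ)`, a member record `MemberOn (T (k+1))` on every row `k` of the segment. The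
phase half `(s, ṡ)` of that record is constructed here from phase-INDEPENDENT data:
`segment_members` produces a single pair `(s, ṡ)`, `s (T 0) = σ₀`, that is a member on every row of
the segment, from — per row — the open domain, the ODE with defect, the continuity of the phase
speed, the TUBE defect class and the maximal-domain property (layer R's obligations, cf.
`RowModel.PhaseHyp`), the constancy of the lock coordinate `p` along the segment, and the start
data `σ₀ ∈ D`, `y_p(σ₀) = x̂_p(0)`, start box at `σ₀`.
PROOF: induction on the number of rows. The per-row existence is `RowModel.phase_global`; the start
data of row `k+1` is read off the end of the member on row `k` (`σ := s (T (k+1)) ∈ D`; the lock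
carries because the junction check makes the reference continuous across the junction in every
coordinate and `p` does not change; the start box is `segment_sound`'s start-box invariant +
`row_end` + `junction_hu0`); the per-row phase maps are glued at `T (k+1)` (`MemberOn.congr`:
membership only reads the phase map on the row's own time interval). `toModel_withPhase`: replacing
the phase of a row model is replacing it in the member data (`rfl`).

[cite: Tao2016AveragedNS, §5.5 Thm 5.3 (5.5)]
-/

namespace Summit.NavierStokesRegularity.FluidComputer

namespace RowModel

open Set Real Filter Topology Matrix

variable {ι : Type*} {κ : Type*} [Fintype ι] [Fintype κ] {R : RowModel ι κ} [DecidableEq κ]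
  [DecidableEq ι]

omit [Fintype ι] [Fintype κ] [DecidableEq κ] [DecidableEq ι] in
/-- **Membership only reads the phase map on `[T₀, Ts]`** (and its rate on `[T₀, Ts)`): a pair that
agrees there with a member's phase is a member. [folklore] -/
def MemberOn.congr {Ts : ℝ} (hm : R.MemberOn Ts) {s' sd' : ℝ → ℝ}
    (hs : ∀ t ∈ Icc R.T₀ Ts, s' t = R.s t) (hsd : ∀ t ∈ Ico R.T₀ Ts, sd' t = R.sd t) :
    (R.withPhase s' sd').MemberOn Ts where
  hy := hm.hy
  hsc := hm.hsc.congr hs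
  hsd := fun t ht => by
    show HasDerivWithinAt s' (sd' t) (Ici t) t
    rw [hsd t ht]
    refine (hm.hsd t ht).congr_of_eventuallyEq ?_ (hs t (Ico_subset_Icc_self ht))
    filter_upwards [inter_mem_nhdsWithin (Ici t) (Iio_mem_nhds ht.2)] with r hr
    exact hs r ⟨ht.1.trans hr.1, le_of_lt hr.2⟩
  hsD := fun t ht => by
    show s' t ∈ R.D
    rw [hs t ht]
    exact hm.hsD t ht
  hlock := fun t ht => by
    show R.y (s' t) R.p = R.xh t R.p
    rw [hs t ht]
    exact hm.hlock t ht
  hδ := fun t ht hE a => by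
    show |R.δF (s' t) a| ≤ R.δ a
    rw [hs t ht]
    refine hm.hδ t ht (fun b => ?_) a
    have h := hE b
    have h1 : (R.withPhase s' sd').e t b = R.e t b := by
      show R.y (s' t) b - R.xh t b = R.y (R.s t) b - R.xh t b
      rw [hs t ht]
    rwa [h1] at h

end RowModel

open Literature.Analysis.FluidPDE.FluidComputer

namespace RowCheck

open DIVec ChainField Finset Real Set Matrix

namespace RowData

variable {r : RowData}

/-- Replacing the phase of a row model is replacing it in the member data. [folklore] -/
theorem toModel_withPhase (Fr : r.Frames) (G : r.GateOK) (T0 : ℝ) (m : MemberData)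
    (s sd : ℝ → ℝ) :
    (toModel Fr G T0 m).withPhase s sd = toModel Fr G T0 ⟨m.y, m.δF, m.D, s, sd⟩ := rfl

/-- Row end of the model is the next row's start. [folklore] -/
theorem T1_eq_of_runOK (Fr : r.Frames) (G : r.GateOK) (T0 : ℝ) (m : MemberData)
    (hr : r.runOK = true) : (toModel Fr G T0 m).T₁ = T0 + r.Hq := by
  obtain ⟨hok, he, -, -⟩ := (runOK_iff _).mp hr
  obtain ⟨-, -, -, hh, -⟩ := flags hok
  obtain ⟨-, -, -, hmS⟩ := (encOK_iff r).mp he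
  exact T1_eq Fr G T0 m hh hmS

/-- **Reference continuity across a junction**, every coordinate. [folklore] -/
theorem xh_junction {r r' : RowData} (hj : juncOK r r' = true) (a : Fin 9) :
    xh r'.CQ 0 a = xh r.CQ r.Hq a := by
  obtain ⟨-, -, hx, -⟩ := juncOK_iff.mp hj
  rw [show (0 : ℝ) = ((0 : ℚ) : ℝ) by simp, xh_ratCast, xh_ratCast, hx a]

/-- **LAYER A′, GLOBAL PER SEGMENT: the phase map exists along a whole segment.** For rows
`R 0, …, R (n-1)` (all passing the run check, consecutive ones passing the junction check, one lock
coordinate), one member `(y, δF, D)` with layer R's phase-independent hypotheses on every row, and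
start data at `σ₀`, there is ONE phase pair `(s, ṡ)`, `s (T 0) = σ₀`, that is a member on every
row — exactly the hypothesis `hmem` of `segment_sound`. [folklore] -/
theorem segment_members (R : ℕ → RowData) (hf : ∀ k, (R k).framesOK = true)
    (Gk : ∀ k, (R k).GateOK)
    (T : ℕ → ℝ) (hT : ∀ k, T (k + 1) = T k + (R k).Hq) (n : ℕ)
    (hrun : ∀ k < n, (R k).runOK = true)
    (hj : ∀ k, k + 1 < n → juncOK (R k) (R (k + 1)) = true)
    (hp : ∀ k, k + 1 < n → (R (k + 1)).p = (R k).p)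
    {y δF : ℝ → Fin 9 → ℝ} {D : Set ℝ} (hDo : IsOpen D)
    (hy : ∀ k < n, ∀ σ ∈ D, ∀ a,
      HasDerivAt (fun τ => y τ a) (F (Gk k).g (Gk k).Λ (y σ) a + δF σ a) σ)
    (hFc : ∀ k < n,
      ContinuousOn (fun σ => F (Gk k).g (Gk k).Λ (y σ) (R k).p + δF σ (R k).p) D)
    (htube : ∀ k < n, ∀ σ ∈ D, ∀ t ∈ Icc (T k) (T (k + 1)),
      (∀ a, |y σ a - xh (R k).CQ (t - T k) a| ≤ (R k).EbarR a) →
        ∀ a, |δF σ a| ≤ (R k).δR a)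
    (hDmax : ∀ K ⊆ D, (∀ a, ∃ C, ∀ σ ∈ K, |y σ a| ≤ C) → closure K ⊆ D)
    {σ₀ : ℝ} (hσ₀ : σ₀ ∈ D) (hlock0 : y σ₀ (R 0).p = xh (R 0).CQ 0 (R 0).p)
    (hu0 : ∀ i,
      |(toModel (canon (hf 0)) (Gk 0) (T 0) ⟨y, δF, D, fun _ => σ₀, fun _ => 0⟩).z (T 0) i|
      ≤ (R 0).ubR 0 i) :
    ∃ s sd : ℝ → ℝ, s (T 0) = σ₀ ∧
      ∀ k < n,
        Nonempty
          ((toModel (canon (hf k)) (Gk k) (T k) ⟨y, δF, D, s, sd⟩).MemberOn (T (k + 1))) := by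
  -- the junction times increase
  have hTlt : ∀ k < n, T k < T (k + 1) := fun k hk => by
    rw [hT k]
    linarith [Hq_pos (r := R k) ((runOK_iff _).mp (hrun k hk)).1]
  have hTmono : ∀ k k', k ≤ k' → k' ≤ n → T k ≤ T k' := by
    intro k k' hkk' hk'n
    induction k', hkk' using Nat.le_induction with
    | base => exact le_rfl
    | succ k' hkk' ih => exact (ih (by omega)).trans (hTlt k' (by omega)).le
  -- the start box of row `0`, for any phase pair starting at `σ₀`
  have hz0 : ∀ s sd : ℝ → ℝ, s (T 0) = σ₀ →
      ∀ i, |(toModel (canon (hf 0)) (Gk 0) (T 0) ⟨y, δF, D, s, sd⟩).z (T 0) i| ≤ (R 0).ubR 0 i := by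
    intro s sd hs0 i
    have h : (toModel (canon (hf 0)) (Gk 0) (T 0) ⟨y, δF, D, s, sd⟩).z (T 0) =
        (toModel (canon (hf 0)) (Gk 0) (T 0) ⟨y, δF, D, fun _ => σ₀, fun _ => 0⟩).z (T 0) := by
      simp only [RowModel.z]
      congr 1
      funext a
      show y (s (T 0)) a - _ = y σ₀ a - _
      rw [hs0]
      rfl
    rw [h]
    exact hu0 i
  -- induction on the number of rows
  suffices H : ∀ n' ≤ n, ∃ s sd : ℝ → ℝ, s (T 0) = σ₀ ∧
      ∀ k < n',
        Nonempty ((toModel (canon (hf k)) (Gk k) (T k) ⟨y, δF, D, s, sd⟩).MemberOn (T (k + 1))) from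
    H n le_rfl
  intro n' hn'
  induction n' with
  | zero =>
    exact ⟨fun _ => σ₀, fun _ => 0, rfl, fun k hk => absurd hk (Nat.not_lt_zero k)⟩
  | succ n' ih =>
    obtain ⟨s, sd, hs0, hmem⟩ := ih (by omega)
    have hn : n' < n := by omega
    have hr := hrun n' hn
    obtain ⟨hok, he, -, hl⟩ := (runOK_iff _).mp hr
    -- the model of row `n'` with the old phase, its certificate, its row end
    set Rn := toModel (canon (hf n')) (Gk n') (T n') ⟨y, δF, D, s, sd⟩ with hRn
    have hc : Rn.Cert :=
      cert (canon (hf n')) (Gk n') (T n') _ hok he (canon_hrow (hf n') hl)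
    have hT1 : Rn.T₁ = T (n' + 1) := by rw [hT n']; exact T1_eq_of_runOK _ _ _ _ hr
    -- start data of row `n'` at `σ := s (T n')`
    have hstart : s (T n') ∈ D ∧ y (s (T n')) (R n').p = xh (R n').CQ 0 (R n').p ∧
        ∀ i, |Rn.z (T n') i| ≤ (R n').ubR 0 i := by
      rcases Nat.eq_zero_or_eq_succ_pred n' with h0 | hS
      · subst h0
        rw [hs0]
        exact ⟨hσ₀, hlock0, hz0 s sd hs0⟩
      · set k := n'.pred with hk
        rw [hS]
        have hkn : k < n := by omega
        have hkn' : k < n' := by omega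
        obtain ⟨hokk, hek, -, hlk⟩ := (runOK_iff _).mp (hrun k hkn)
        have m := (hmem k hkn').some
        have hH : ((R k).Hq : ℝ) ≠ 0 := (Hq_pos (r := R k) hokk).ne'
        -- start boxes of the old member along rows `< n'`, hence its end box on row `k`
        have hst := segment_sound R hf Gk T hT ⟨y, δF, D, s, sd⟩ n'
          (fun j hj' => hrun j (by omega))
          (fun j hj' => hj j (by omega)) (fun j hj' => (hmem j hj').some) (hz0 s sd hs0)
        have hzend := row_end (canon (hf k)) (Gk k) (T k) ⟨y, δF, D, s, sd⟩ hokk hek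
          (canon_hrow (hf k) hlk)
          (by rw [← hT]; exact m) (hst k hkn').1
        have hzn := junction_hu0 (hj k (by omega)) (hf k) (hf (k + 1)) (Gk k) (Gk (k + 1)) (T k)
          ⟨y, δF, D, s, sd⟩ hH hzend
        rw [← hT] at hzn
        refine ⟨m.hsD (T (k + 1)) ⟨(hTlt k hkn).le, le_rfl⟩, ?_, ?_⟩
        · have hlck := m.hlock (T (k + 1)) ⟨(hTlt k hkn).le, le_rfl⟩
          change y (s (T (k + 1))) (R k).p = xh (R k).CQ (T (k + 1) - T k) (R k).p at hlck
          rw [hp k (by omega), xh_junction (hj k (by omega)), hlck, hT k, add_sub_cancel_left]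
        · intro i
          have h := hzn i
          rw [hS] at hRn
          rw [hRn]
          exact h
    obtain ⟨hσD, hlk, hz⟩ := hstart
    -- layer R's hypotheses for row `n'`, at `σ`
    have HP : Rn.PhaseHyp (s (T n')) :=
      { hDo := hDo
        hy := hy n' hn
        hFc := hFc n' hn
        htube := fun σ hσ t ht hE a => by
          have ht' : t ∈ Icc (T n') (T (n' + 1)) := by rw [← hT1]; exact ht
          exact htube n' hn σ hσ t ht' hE a
        hDmax := hDmax
        hσ₀ := hσD
        hlock0 := by
          show y (s (T n')) (R n').p = xh (R n').CQ (T n' - T n') (R n').p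
          rw [sub_self]
          exact hlk
        hu := fun i => hz i }
    -- the phase map on row `n'`
    obtain ⟨s', sd', hs'0, ⟨m'⟩⟩ := RowModel.phase_global hc HP
    rw [hT1] at m'
    -- glue at `T n'`
    refine ⟨fun t => if t ≤ T n' then s t else s' t, fun t => if t < T n' then sd t else sd' t,
      ?_, ?_⟩
    · show (if T 0 ≤ T n' then s (T 0) else s' (T 0)) = σ₀
      rw [if_pos (hTmono 0 n' (Nat.zero_le _) hn.le), hs0]
    · intro k hk
      rcases Nat.lt_succ_iff_lt_or_eq.mp hk with hk' | rfl
      · -- an old row: the glued pair agrees with the old one there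
        have hkT : T (k + 1) ≤ T n' := hTmono (k + 1) n' hk' hn.le
        exact ⟨(hmem k hk').some.congr
          (fun t ht => by
            show (if t ≤ T n' then s t else s' t) = s t; rw [if_pos (ht.2.trans hkT)])
          (fun t ht => by
            show (if t < T n' then sd t else sd' t) = sd t
            rw [if_pos (lt_of_lt_of_le ht.2 hkT)])⟩
      · -- the new row
        exact ⟨m'.congr
          (fun t ht => by
            show (if t ≤ T k then s t else s' t) = s' t
            by_cases htk : t ≤ T k
            · have hs'T : s' (T k) = s (T k) := hs'0
              rw [if_pos htk, le_antisymm htk ht.1, hs'T]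
            · rw [if_neg htk])
          (fun t ht => by
            show (if t < T k then sd t else sd' t) = sd' t
            rw [if_neg (not_lt.mpr (show T k ≤ t from ht.1))])⟩

end RowData

end RowCheck

end Summit.NavierStokesRegularity.FluidComputer
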